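import Summits.Parity.BatemanHorn.Theses.IsogenyRedei
import Mathlib.LinearAlgebra.QuadraticForm.Basic
import Literature.NumberTheory.EllipticCurves.BSDRankZeroDensityProofs
import Literature.NumberTheory.EllipticCurves.TwoTorsionCardProofs

/-!
# Line `isotrivial-two-torsion-relative-parity` for crux `PencilSelmerDictionary` (stmt-Parity-11584)

Crux (route `IsogenyRedei`, rank 3):
`∃ M w, (∀ t, w (t + 2^M) = w t) ∧ ∀ t ≥ 1, (−1)^{corank_{ℤ₂} Sel_{2^∞}(E_t/ℚ)} = −(w t · (−1)^{#odd p ∣ t²+1})`,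
`E_t = ⟨0, 2t, 0, t²+1, 0⟩ : y² = x((x+t)²+1) = x(x − e₊)(x − e₋)`, `e± = −t ± i`.

Gen 2 of the line (planner `…-isotrivial-two-torsi-g2-0`, 2026-08-16; gen 1 = 4 stubs, same slug):
the pure-𝔽₂ engine of the Klagsbrun–Mazur–Rubin comparison theorem — the THREE-LAGRANGIAN PARITY
LEMMA (arXiv:1111.2321 Lemma 2.3 + Prop. 2.4) — is now its own registered stub
`stub_threeLagrangianParity`, stated over Mathlib's `QuadraticForm (ZMod 2)` (provable now: the
"standard argument" it needs is the tree's `Literature.GroupTheory.FiniteAbelian.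
even_finrank_of_isAlt_of_nondegenerate`), and `stub_relativeParity` CONSUMES it as its first
hypothesis (same device as the toric image), so the arithmetic stub no longer hides a page of linear
algebra; five stubs, `of_parts` / `PencilSelmerDictionary_of` re-proved. Also recorded (line card):
the local index `#E(ℚ_p)/2E(ℚ_p) = c_p·#E(ℚ_p)[2]` that makes Kummer images half-dimensional is
ALREADY PROVED in the tree (`brumerKramer_card_quotient_two_holds`), as are Hilbert reciprocity over
`ℚ` (`hilbertReciprocity_rat`) and the `S`-unit rank (`finrank_sUnit`) — stub 4's cost is the
cohomological identification, not these.

## The line (idea card `isotrivial-two-torsion-relative-parity`, merged per triage r1 with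
## `constant-two-torsion-lagrangian`)

`E_t[2] = {O, (0,0), (e₊,0), (e₋,0)} ≅ T := Ind_{ℚ(i)}^ℚ 𝔽₂` for EVERY `t` (the pencil is
`E[2]`-isotrivial), so all `Sel₂(E_t) ⊂ H¹(ℚ, T) = ℚ(i)ˣ/ℚ(i)ˣ²` (Shapiro) are Lagrangian Selmer
structures on ONE self-dual module, and the Klagsbrun–Mazur–Rubin comparison theorem
(arXiv:1111.2321 Thm 3.9 = Thm (compsel), seq. no. 14) reads, for any two fibres `t, t'`:
  `dim Sel₂(E_t) − dim Sel₂(E_t') ≡ Σ_v dim W_v(t)/(W_v(t) ∩ W_v(t'))  (mod 2)`,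
`W_v(t) ⊂ H¹(ℚ_v, T)` the local Kummer image. Place by place:
* odd `p ∣ t²+1` (split multiplicative, `i ∈ ℚ_p`): `W_p(t)` is the TORIC LINE `{1} × ℚ_pˣ/□` in the
  `2`-descent coordinates `(x − e_far, x − e_near)` (`e_far` the root with `|t + i|_p < 1`, i.e. the
  `2`-torsion point on the identity component) — `stub_toricKummerImage`; against the unramified
  condition of a fibre with good reduction at `p` the jump is `2 − 1 = 1` (ODD); if `p` divides both
  values the two toric lines coincide or are transverse (jump `0` or `2`, EVEN);
* odd `p ∤ (t²+1)(t'²+1)`: both unramified, jump `0`;  `v = ∞`: `H¹(ℝ, Ind_ℂ^ℝ 𝔽₂) = 0`, jump `0`;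
* `v = 2`: `H¹(ℚ₂, T) = ℚ₂(i)ˣ/ℚ₂(i)ˣ²` (16 classes), `W₂(t) = {1} ∪ {class of x(P) + t − i}`, and
  `W₂(t) = W₂(t')` whenever `t ≡ t' (mod 8)` (the same abscissa `x` works) — `stub_twoAdicKummerImage`;
so for `t ≡ t' (mod 8)`: `s₂(t) + s₂(t') ≡ #(primes toric for exactly one of the two fibres)
≡ ω_odd(t) + ω_odd(t')` — `stub_relativeParity`, the KMR comparison for this `T` with EVERYTHING
EXPLICIT (triage r1-2 gen 2, §q0): the common global metabolic structure (KMR Def. 3.2 = Def. (ahsdef))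
is the `t`-FREE quaternion class `q₀,v(α) := (−Im α, N α)_v` (Hilbert symbol over `ℚ_v`; = local
invariant of the conic `Im(α z²) + w² = 0`, the rank-3 rational cone `Q₁` of EVERY 2-covering
`Q₁ ∩ {Re(αz²) − N(α)y₁² − t y₀² = 0}` of EVERY `E_t`, so all Kummer images are `q₀`-isotropic at once),
reciprocity `Σ_v q₀,v = 0` on `ℚ(i)ˣ` is the Hilbert product formula over `ℚ` (tree, PROVED:
`hilbertReciprocity_rat`), the Lagrangian of global classes is `ℚ(i)(Σ, 2)` (S-units of `ℤ[i]`,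
`h = 1`, `dim = #Σ_f(ℚ(i)) + 1 = ½ dim ⊕_v H¹(ℚ_v, T)`; tree `finrank_sUnit`), and Thm 3.9 is the
three-Lagrangian linear algebra `dim X∩Y + dim Y∩Z + dim Z∩X ≡ dim X (mod 2)` — `stub_threeLagrangianParity`.
Cassels–Tate (`stub_casselsTatePairing`, the tree's named fact bsd.S18, through the PROVED
`exists_selmerRank_eq_add`) and `#E_t(ℚ)[2] = 2` (PROVED here, `natCard_twoTorsion`) turn `s₂` into
`1 + corank + 2m`, and the normal-form step (periodicity ⇒ ∃ w, PROVED here, `of_parts`) gives the crux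
with `M = 3`, `w t := (−1)^{corank(r)+ω_odd(r)+1}`, `r = t mod 8 + 8` — NO root number, ε-factor,
Tamagawa number or 2-adic image table is ever evaluated (contrast: the Cassels lines A/C/E).

`H¹(ℚ₂, T)`-classes are written WITHOUT constructing `ℚ₂(i)`: `a + b·i` (`a b : ℚ_[2]`) is a square in
`ℚ₂(i)` iff `∃ c d : ℚ_[2], c² − d² = a ∧ 2cd = b`, and the class of `x + t − i` lies in `W₂(t')` iff
it is trivial or `(x + t − i)(x' + t' − i) = ((x+t)(x'+t') − 1) − ((x+t)+(x'+t'))·i` is a square for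
some `(x', y') ∈ E_{t'}(ℚ₂)`.

Disproof / refuter material honoured (known through the item's evidence notes; `Disproof.lean` itself,
payload path under run/gate/evidence, is not mounted on this hub and the gate socket was unreachable
for `workitem evidence latest` during both generations): NormalForm / cdisprove §1 `iff_periodic` —
this line proves exactly 2^M-periodicity of `σ(t) = (−1)^{corank+ω_odd}` (`of_parts`) and nothing
stronger; §2 `withoutPeriodicity_trivial`/`iff_noSign`/`iff_allPrimes` — `w` is read off base points,
never tabulated; §3/§3b (`AnyPeriod`, `Tables.helfgottClauses_flip`: root-number facts give period
`2^M·3^K` only) — evaded structurally, no root number or ε-table enters and `3 ∤ t²+1` is never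
toric; §2b `Fibres.not_two_pow_nine_dvd_Δ` (no 2-adic singular fibre) is what makes `v_F(x + t − i) ≤ 1`
uniform in stub 2; §4b forced table `w(1..8) = (−1,1,1,−1,−1,1,1,−1)`, `M ≤ 1` refuted — here `M = 3`
(`W₂` has period 8, the parity period 4: consistent, not contradicted); the obstruction common to ALL
lines (Cassels–Tate evenness enters exactly once; it would be the `_false_without_` theorem) is isolated
as `stub_casselsTatePairing`. No `Negative/` lemma has landed for this crux (nothing to import), and
`ledger negatives --problem Parity` lists three sieve-side refutations (stmt-Parity-14832, 9541, 4218),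
none of which any stub instantiates; the new algebra stub is a published lemma (KMR Prop. 2.4) with the
metabolic hypothesis witnessed by `X` itself, so it has no vacuous or junk instance (`V = 0`: `Even 0`).
-/

open scoped Classical

namespace Summit.Parity.BatemanHorn.Cruxes.PencilSelmerDictionary.IsotrivialTwoTorsionRelativeParity

open WeierstrassCurve Literature.NumberTheory.EllipticCurves

/-! ## Registered stubs

All five are stated over Mathlib + `Literature` declarations only (no local definition), so that each
can be proved verbatim in a `Theorems/` file. Dependency inside the line: stub 4 consumes the
STATEMENTS of stubs 1 and 3 as hypotheses (so their provers' work is not redone inside stub 4), stub 2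
feeds stub 4's equal-2-adic-image hypotheses in `of_parts`, stub 5 is the Cassels–Tate currency. -/

/-- **stub 1 — toric Kummer image at a split multiplicative fibre** (card `constant-two-torsion-lagrangian`,
first lemma; local, provable now, M). For odd `p ∣ t²+1` pick `i ∈ ℚ_p`, `i² = −1`, on the branch
`|t + i|_p < 1`; then `e_far := −t + i ≡ −2t` is a `p`-adic unit and `(2t|p) = +1` (`p ≡ 1 (4)`, `t` of
order `4`), and for EVERY affine `P = (x, y) ∈ E_t(ℚ_p)` with `x ≠ e_far`, `x − e_far ∈ ℚ_pˣ²`: the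
first `2`-descent coordinate of the Kummer image is trivial, i.e. `W_p(t) ⊆ {1} × ℚ_pˣ/ℚ_pˣ²` (and `=`,
by `#E(ℚ_p)/2E(ℚ_p) = #E(ℚ_p)[2] = 4`). Tate-curve reading: `E_t ≅ ℚ_pˣ/qℤ` with `√q ∈ ℚ_p`, the
half-points of `P` generate `ℚ_p(√u)`, so the Kummer cocycle is valued in `⟨T_far⟩ = μ₂`. Elementary
proof: case analysis on `v_p(x)` in `y² = x(x − e_far)(x − e_near)` with `e_near = −t − i ∈ pℤ_p`
(triage r1-3 hand check; kit j010573: 0 failures on 5400 sampled points, `t ≤ 60`).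
Sources: Silverman AEC X.1.4, C.14; Brumer–Kramer 1977 §2; arXiv:1111.2321 §5. -/
theorem stub_toricKummerImage :
    ∀ t : ℕ, 1 ≤ t → ∀ (p : ℕ) [Fact p.Prime], p ≠ 2 → ∀ i : ℚ_[p], i ^ 2 = -1 →
      ‖(t : ℚ_[p]) + i‖ < 1 →
      ∀ x y : ℚ_[p], y ^ 2 = x ^ 3 + 2 * (t : ℚ_[p]) * x ^ 2 + ((t : ℚ_[p]) ^ 2 + 1) * x →
        x ≠ -(t : ℚ_[p]) + i → IsSquare (x - (-(t : ℚ_[p]) + i)) := by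
  sorry

/-- **stub 2 — the 2-adic Kummer image is constant on classes mod 8** (local at `v = 2`, provable
now, M). `W₂(t) := {1} ∪ {class of x(P) + t − i : P ∈ E_t(ℚ₂) affine} ⊂ F ˣ/F ˣ²`, `F = ℚ₂(i)`
(`= H¹(ℚ₂, E_t[2])` by Shapiro, the Kummer map being `P ↦ x(P) − e₊`; 16 classes, `#W₂(t) = 4`).
Statement: `t ≡ t' (mod 8)`, `t, t' ≥ 1` ⇒ `W₂(t) ⊆ W₂(t')` (hence `=` by symmetry), spelled out on
representatives: for every `(x, y) ∈ E_t(ℚ₂)` the class of `x + t − i` is trivial or equals the class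
of `x' + t' − i` for some `(x', y') ∈ E_{t'}(ℚ₂)`. PROOF SKETCH (take `x' := x`): `v_F(x + t − i) ≤ 1`
for every `x ∈ ℚ₂` (`N(a − i) = a² + 1 ≢ 0 mod 4`), so `u := (t' − t)/(x + t − i)` has `v_F(u) ≥ 6 − 1 = 5`
(`π = 1 + i`, `v_F(8) = 6`); Hensel: `1 + π⁵𝓞_F = (1 + π³𝓞_F)²`, so `x + t' − i = (x + t − i)(1 + u)` has
the class of `x + t − i`, and `x((x + t')² + 1) = y² · N(1 + u) ∈ ℚ₂²` gives the point `(x, y·N(c))`,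
`c² = 1 + u`, on `E_{t'}`. (Soft alternative: clopen solubility of the 2-coverings + compactness of
`ℤ₂`, cf. the tree's `isClosed_setOf_isSoluble`, `exists_pow_dvd_imp_isSoluble_iff_int`.) Numerics
(kit j010564, `t ≤ 96`; triage g2 `q0_check.out`): `W₂(t)` is a function of `t mod 8` with six values
`P₀ = P₄, P₂ = P₆, P₁, P₅, P₃, P₇` — exactly the six totally singular planes of the form `q₀` below.
Sources: Silverman AEC X.1.1/X.4.9 (Kummer map via `x − e`), Serre *Cours d'arithmétique* II.3
(2-adic squares); arXiv:1111.2321 §5. -/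
theorem stub_twoAdicKummerImage :
    ∀ t t' : ℕ, 1 ≤ t → 1 ≤ t' → t ≡ t' [MOD 8] →
      ∀ x y : ℚ_[2], y ^ 2 = x ^ 3 + 2 * (t : ℚ_[2]) * x ^ 2 + ((t : ℚ_[2]) ^ 2 + 1) * x →
        (∃ c d : ℚ_[2], c ^ 2 - d ^ 2 = x + t ∧ 2 * c * d = -1) ∨
        ∃ x' y' : ℚ_[2], y' ^ 2 = x' ^ 3 + 2 * (t' : ℚ_[2]) * x' ^ 2 + ((t' : ℚ_[2]) ^ 2 + 1) * x' ∧
          ∃ c d : ℚ_[2], c ^ 2 - d ^ 2 = (x + t) * (x' + t') - 1 ∧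
            2 * c * d = -((x + t) + (x' + t')) := by
  sorry

/-- **stub 3 — the three-Lagrangian parity lemma** (Klagsbrun–Mazur–Rubin, arXiv:1111.2321 §2:
Lemma 2.3 = Lemma (ell1) and Prop. 2.4 = Prop. (ell2); pure linear algebra over `𝔽₂`, provable NOW, M).
For a finite-dimensional `𝔽₂`-space `V` with a quadratic form `Q` whose polar form
`(x,y) ↦ Q(x+y) − Q x − Q y` is nondegenerate, and three subspaces `X, Y, Z` that are LAGRANGIAN
(`Q` vanishes on them and they are half-dimensional; with a nondegenerate polar form this is KMR's
`X = X^⊥ ∧ q(X) = 0`, and `X` itself witnesses that `(V, Q)` is a metabolic "space"):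
  `dim X∩Y + dim Y∩Z + dim Z∩X ≡ dim X = ½ dim V (mod 2)`.
This is the engine of KMR Thm 3.9 (applied in stub 4 to `X = ⊕_v W_v(t)`, `Y = ⊕_v W_v(t')`,
`Z = loc ℚ(i)(Σ,2)` inside `V = ⊕_{v∈Σ} H¹(ℚ_v, T)` with `Q = Σ_v q₀,v`): it gives
`dim X∩Z − dim Y∩Z ≡ dim X/(X∩Y) (mod 2)`, i.e. "Selmer rank difference ≡ sum of local jumps".
PROOF (KMR, one page): Lemma 2.2 `W^⊥ ∩ X + W` is Lagrangian for `q(W) = 0` (Poonen–Rains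
arXiv:1009.0287 §2); Lemma 2.3: `[z,z'] := (x, y')_q` (`z = x + y`) is a well-defined ALTERNATING
nondegenerate pairing on `((X+Y) ∩ Z)/(X∩Z + Y∩Z)`, so that quotient is even-dimensional — the
"standard argument" is the tree's PROVED `Literature.GroupTheory.FiniteAbelian.even_finrank_of_isAlt_of_nondegenerate`;
Prop. 2.4: `dim U + dim W = dim(U+W) + dim(U∩W)` twice, and `(X+Y)∩Z + X∩Y` is Lagrangian hence of
dimension `dim X`. Sanity: hyperbolic plane `Q(a,b) = ab` over `𝔽₂` has exactly the two Lagrangian lines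
`⟨(1,0)⟩, ⟨(0,1)⟩` (the two rulings, `n = 1`): triples give `3, 1, 1` — all `≡ 1`; `V = 0` gives `Even 0`.
Mathlib vocabulary: `QuadraticForm (ZMod 2) V`, `QuadraticMap.polar`, `Submodule`, `Module.finrank`.
Sources: arXiv:1111.2321 Lemma 2.2–Prop. 2.4 (Ann. of Math. 178 (2013) §2); arXiv:1009.0287 §2
(Prop. 2.3–2.6: maximal isotropic subspaces, the two rulings); Howard / Mazur–Rubin visibility (cited there). -/
theorem stub_threeLagrangianParity :
    ∀ (V : Type) [AddCommGroup V] [Module (ZMod 2) V] [Module.Finite (ZMod 2) V]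
      (Q : QuadraticForm (ZMod 2) V),
      (∀ x : V, (∀ y : V, QuadraticMap.polar Q x y = 0) → x = 0) →
      ∀ X Y Z : Submodule (ZMod 2) V,
        (∀ x ∈ X, Q x = 0) → (∀ y ∈ Y, Q y = 0) → (∀ z ∈ Z, Q z = 0) →
        2 * Module.finrank (ZMod 2) X = Module.finrank (ZMod 2) V →
        2 * Module.finrank (ZMod 2) Y = Module.finrank (ZMod 2) V →
        2 * Module.finrank (ZMod 2) Z = Module.finrank (ZMod 2) V →
        Even (Module.finrank (ZMod 2) ↥(X ⊓ Y) + Module.finrank (ZMod 2) ↥(Y ⊓ Z) +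
          Module.finrank (ZMod 2) ↥(Z ⊓ X) + Module.finrank (ZMod 2) X) := by
  sorry

/-- **stub 4 — relative (Lagrangian) parity along the pencil: the Klagsbrun–Mazur–Rubin comparison
theorem on the constant module `T = E_t[2] ≅ Ind_{ℚ(i)}^ℚ 𝔽₂`, made explicit by the quaternion form
`q₀`** (global; HARDEST; XL in Lean — the identification of the tree's cohomological
`WeierstrassCurve.selmerGroup W 2` (continuous `H¹(Γ_ℚ, E[2])`, local kernels into `H¹(ℚ_v, E)`) with the
explicit Kummer-condition group in `ℚ(i)ˣ/ℚ(i)ˣ²` is not in the tree; KMR's Selmer-structure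
vocabulary exists only generically as `Literature.NumberTheory.GaloisRepresentations.SelmerStructure`).
GIVEN the three-Lagrangian parity lemma (stub 3, consumed once, for `V = ⊕_{v∈Σ} H¹(ℚ_v,T)`) and the
toric local image (stub 1, consumed at the odd primes of `(t²+1)(t'²+1)`), for two fibres `t, t' ≥ 1`
whose 2-adic Kummer images agree (`W₂(t) ⊆ W₂(t')` and `W₂(t') ⊆ W₂(t)`, in the representative
spelling of stub 2) and `#Sel₂(E_t) = 2^s`, `#Sel₂(E_{t'}) = 2^{s'}`:
  `Even (s + s' + #(A ∖ B) + #(B ∖ A))`, `A, B` = odd prime factors of `t²+1`, `t'²+1`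
(one unit of jump per prime that is toric for exactly one of the two fibres). Proof obligations inside,
all for the ONE module `T` (triage r1-2 gen 2 §q0 settles the card's risk R1 constructively; KMR
numbering = arXiv:1111.2321 sequential / Annals §-numbers):
(i) `q₀,v(α) := (−Im α, N α)_v` on `H¹(ℚ_v, T) = (ℚ_v ⊗ ℚ(i))ˣ/□` is a Tate quadratic form (KMR
Def. 7 = Def. 3.1: polar form = the Weil-twisted local Tate pairing; split `p`: `q₀ = (−cα₁, cα₂)_p`,
polar `(α₁,β₂)_p(α₂,β₁)_p`; `v = 2`: certified numerically — class function on the 16 classes,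
nondegenerate, 10 zeros — kit `q0_check.out`, triage g2), `(H¹(ℚ_v,T), q₀,v)` is a space, `q₀,v` is
unramified at odd `v` (vanishes on units) and — because `(2t|p) = +1` — vanishes on the toric line
`{1} × ℚ_pˣ/□` of stub 1; every Kummer image `W_v(t)` of every `E_t` is `q₀`-isotropic (the 2-covering
of `α` is `Q₁ ∩ Q₂ = {Im(αz²) + y₀² = 0} ∩ {Re(αz²) − N(α)y₁² − t y₀² = 0}`, a 2:1 cover — projection
from the vertex of the `t`-FREE rank-3 cone `Q₁` — of the conic `Im(αz²) + w² = 0`, so a `ℚ_v`-point of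
the covering gives one on the conic: tree `hilbertSymbol_eq_one_of_ternary_zero`) and HALF-DIMENSIONAL
by the PROVED tree theorem `brumerKramer_card_quotient_two_holds`
(`#E(ℚ_p)/2E(ℚ_p) = c_p · #E(ℚ_p)[2]`, `c₂ = 2`, `c_p = 1`: `4 = √16` at `p = 2` since `i ∉ ℚ₂`,
`4 = √16` at split toric `p`, `2` or `4 = √(4 or 16)` at good odd `p`), hence `q₀`-Lagrangian;
(ii) `{q₀,v}_v` is a global metabolic structure (KMR Def. 8 = Def. 3.2): `Σ_v q₀,v(α) = 0` for
`α = a + bi ∈ ℚ(i)ˣ` is the tree's PROVED `hilbertReciprocity_rat (−b) (a²+b²)`; the global Lagrangian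
`Z = loc ℚ(i)(Σ,2) ⊂ ⊕_{v∈Σ} H¹(ℚ_v,T)` is `q₀`-isotropic by (ii) and has dimension
`#Σ_f(ℚ(i)) + 1 = ½ Σ_{v∈Σ} dim H¹(ℚ_v,T)` (S-units of `ℤ[i]`, `h(ℤ[i]) = 1`, torsion `⟨i⟩`: tree
`finrank_sUnit`; `loc` injective because `ℚ(i)` has no quadratic extension unramified outside `Σ ∋ (1+i)`
and split at `Σ`), hence Lagrangian — this is Poitou–Tate for `T` by genus theory, no appeal to the
tree's named `poitouTate_sum_localTatePairing_eq_zero` needed; (iii) stub 3 with `X = ⊕W_v(t)`,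
`Y = ⊕W_v(t')`, `Z` as above: `dim X∩Z + dim Y∩Z ≡ dim X + dim X∩Y`, i.e.
`s + s' ≡ Σ_v dim W_v(t)/(W_v(t) ∩ W_v(t'))` (KMR Thm 14 = Thm 3.9, whose proof is exactly this);
(iv) the identification of `WeierstrassCurve.selmerGroup W 2` (classes dying in every `H¹(ℚ_v, E)`)
with `X ∩ Z = {α ∈ ℚ(i)(Σ,2) : loc_v α ∈ W_v(t) ∀ v ∈ Σ}` (Shapiro for `Ind_{ℚ(i)}^ℚ μ₂` + exactness of
the local Kummer sequences, AEC X.4.2, the tree's named `exists_kummerMap` pattern; unramified = Kummer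
image at good odd `p`: tree `selmerGroup_le_h1Unramified_holds`) — THIS is the XL part;
(v) local dictionary: jump 1 = `dim({1}×all / {1}×units)` at a prime toric for one fibre only, 0 or 2
at a common toric prime (same or opposite branch of `i`: `t ≡ ±t' mod p`), 0 at odd good primes
(`W = H¹_ur` for both), 0 at `∞` (`H¹(ℝ, Ind_ℂ^ℝ 𝔽₂) = H¹(ℂ, 𝔽₂) = 0`), 0 at 2 by hypothesis.
NOT implied by the crux (it is the equal-2-adic-image criterion for ARBITRARY pairs) and does not imply
it without stub 2; not weakened by its two consumed hypotheses (both are theorems: stub 3 is KMR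
Prop. 2.4, stub 1 the Tate-curve toric image). Consistency: `τ(t) := (−1)^{s₂+ω_odd} = w(t mod 4)` on
all cards' tables, and `W₂(t) = W₂(t') ⇒ t ≡ t' (mod 4)`; sharper falsifiable prediction of (i)–(iii)
for ALL pairs (the 2-adic ruling law) `(−1)^{dim W₂(t) ∩ W₂(t')} = τ(t)τ(t')`: 0 violations on 4656
pairs (kit j010564) and 0/576 against the explicit `q₀` (triage g2); e.g. `(t,t') = (2,18)`: equal
`W₂`, `A = {5}`, `B = {5,13}` with `18 ≡ −2 (mod 5)` (transverse toric lines at 5, jump 2): predicted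
`s₂(2) + s₂(18)` odd ✓ (`τ = +1, +1`).
Sources: arXiv:1111.2321 Thm 3.9 (= Thm 14) with Def. 3.1–3.2, Thm 3.? (tateprop) + §5;
arXiv:1009.0287 §4 and Prop 2.3 (O'Neil isotropy); arXiv:0904.3709; Milne ADT I.4.10, I.2.?;
Serre *Cours d'arithmétique* III (Hilbert symbol, product formula); Silverman AEC X.4.2, VII.6.3;
Brumer–Kramer 1977 (= Bhargava–Shankar Lemma 5.16, tree). -/
theorem stub_relativeParity :
    (∀ (V : Type) [AddCommGroup V] [Module (ZMod 2) V] [Module.Finite (ZMod 2) V]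
       (Q : QuadraticForm (ZMod 2) V),
       (∀ x : V, (∀ y : V, QuadraticMap.polar Q x y = 0) → x = 0) →
       ∀ X Y Z : Submodule (ZMod 2) V,
         (∀ x ∈ X, Q x = 0) → (∀ y ∈ Y, Q y = 0) → (∀ z ∈ Z, Q z = 0) →
         2 * Module.finrank (ZMod 2) X = Module.finrank (ZMod 2) V →
         2 * Module.finrank (ZMod 2) Y = Module.finrank (ZMod 2) V →
         2 * Module.finrank (ZMod 2) Z = Module.finrank (ZMod 2) V →
         Even (Module.finrank (ZMod 2) ↥(X ⊓ Y) + Module.finrank (ZMod 2) ↥(Y ⊓ Z) +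
           Module.finrank (ZMod 2) ↥(Z ⊓ X) + Module.finrank (ZMod 2) X)) →
    (∀ t : ℕ, 1 ≤ t → ∀ (p : ℕ) [Fact p.Prime], p ≠ 2 → ∀ i : ℚ_[p], i ^ 2 = -1 →
       ‖(t : ℚ_[p]) + i‖ < 1 →
       ∀ x y : ℚ_[p], y ^ 2 = x ^ 3 + 2 * (t : ℚ_[p]) * x ^ 2 + ((t : ℚ_[p]) ^ 2 + 1) * x →
         x ≠ -(t : ℚ_[p]) + i → IsSquare (x - (-(t : ℚ_[p]) + i))) →
    ∀ t t' : ℕ, 1 ≤ t → 1 ≤ t' →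
      (∀ x y : ℚ_[2], y ^ 2 = x ^ 3 + 2 * (t : ℚ_[2]) * x ^ 2 + ((t : ℚ_[2]) ^ 2 + 1) * x →
        (∃ c d : ℚ_[2], c ^ 2 - d ^ 2 = x + t ∧ 2 * c * d = -1) ∨
        ∃ x' y' : ℚ_[2], y' ^ 2 = x' ^ 3 + 2 * (t' : ℚ_[2]) * x' ^ 2 + ((t' : ℚ_[2]) ^ 2 + 1) * x' ∧
          ∃ c d : ℚ_[2], c ^ 2 - d ^ 2 = (x + t) * (x' + t') - 1 ∧
            2 * c * d = -((x + t) + (x' + t'))) →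
      (∀ x' y' : ℚ_[2], y' ^ 2 = x' ^ 3 + 2 * (t' : ℚ_[2]) * x' ^ 2 + ((t' : ℚ_[2]) ^ 2 + 1) * x' →
        (∃ c d : ℚ_[2], c ^ 2 - d ^ 2 = x' + t' ∧ 2 * c * d = -1) ∨
        ∃ x y : ℚ_[2], y ^ 2 = x ^ 3 + 2 * (t : ℚ_[2]) * x ^ 2 + ((t : ℚ_[2]) ^ 2 + 1) * x ∧
          ∃ c d : ℚ_[2], c ^ 2 - d ^ 2 = (x' + t') * (x + t) - 1 ∧
            2 * c * d = -((x' + t') + (x + t))) →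
      ∀ s s' : ℕ,
        Nat.card ((⟨0, 2 * (t : ℚ), 0, (t : ℚ) ^ 2 + 1, 0⟩ : WeierstrassCurve ℚ).selmerGroup 2) = 2 ^ s →
        Nat.card ((⟨0, 2 * (t' : ℚ), 0, (t' : ℚ) ^ 2 + 1, 0⟩ : WeierstrassCurve ℚ).selmerGroup 2) = 2 ^ s' →
        Even (s + s' +
          (((t ^ 2 + 1).primeFactors.filter (fun p : ℕ => p ≠ 2)) \
            ((t' ^ 2 + 1).primeFactors.filter (fun p : ℕ => p ≠ 2))).card +
          (((t' ^ 2 + 1).primeFactors.filter (fun p : ℕ => p ≠ 2)) \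
            ((t ^ 2 + 1).primeFactors.filter (fun p : ℕ => p ≠ 2))).card) := by
  sorry

/-- **stub 5 — the Cassels–Tate pairing on `Ш(E/ℚ)`** (the tree's named fact bsd.S18
`WeierstrassCurve.exists_casselsTate_pairing`, Cassels 1962 / Tate 1963 / Milne ADT I.6.13(a); closable
only when that fact lands with `_holds` — the obstruction shared by EVERY line of this crux, cf. the
refuters' notes: Cassels–Tate evenness enters exactly once). Consumed through the PROVED
`Literature.NumberTheory.EllipticCurves.exists_selmerRank_eq_add`: `s₂ = t₂ + corank + 2m`. -/
theorem stub_casselsTatePairing : WeierstrassCurve.exists_casselsTate_pairing (K := ℚ) := by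
  sorry

/-! ## The pencil: invariants, ellipticity, rational 2-torsion (sorry-free) -/

/-- The pencil `E_t = ⟨0, 2t, 0, t²+1, 0⟩`. Local shorthand ONLY (stubs inline it). -/
abbrev E (t : ℕ) : WeierstrassCurve ℚ := ⟨0, 2 * (t : ℚ), 0, (t : ℚ) ^ 2 + 1, 0⟩

/-- The odd prime factors of `t²+1` (the toric fibres of `E_t`). Local shorthand ONLY. -/
abbrev oddPF (t : ℕ) : Finset ℕ := (t ^ 2 + 1).primeFactors.filter (fun p : ℕ => p ≠ 2)

/-- `ω_odd(t²+1) = #odd p ∣ t²+1`. Local shorthand ONLY. -/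
abbrev ω (t : ℕ) : ℕ := (oddPF t).card

theorem Δ_eq (t : ℕ) : (E t).Δ = -(64 * ((t : ℚ) ^ 2 + 1) ^ 2) := by
  simp only [WeierstrassCurve.Δ, WeierstrassCurve.b₂, WeierstrassCurve.b₄, WeierstrassCurve.b₆,
    WeierstrassCurve.b₈]
  ring

theorem Δ_ne_zero (t : ℕ) : (E t).Δ ≠ 0 := by
  rw [Δ_eq]
  have h : (0 : ℚ) < (t : ℚ) ^ 2 + 1 := by positivity
  have h' : (0 : ℚ) < 64 * ((t : ℚ) ^ 2 + 1) ^ 2 := by positivity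
  intro h0
  linarith [neg_eq_zero.mp h0]

instance instIsElliptic (t : ℕ) :
    WeierstrassCurve.IsElliptic (⟨0, 2 * (t : ℚ), 0, (t : ℚ) ^ 2 + 1, 0⟩ : WeierstrassCurve ℚ) :=
  ⟨isUnit_iff_ne_zero.mpr (Δ_ne_zero t)⟩

section PointLemmas

/-! The tree's point-level lemmas (`isRoot_twoTorsionPolynomial_of_add_self_eq_zero`,
`exists_selmerRank_eq_add`) are stated under `open scoped Classical` for a general field, so their
`DecidableEq` instance on coordinates is `Classical.propDecidable`; we match it in this section. -/
attribute [local instance high] Classical.propDecidable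

/-- `(0,0)` is a nonsingular point of `E_t`. -/
theorem nonsingular_zero (t : ℕ) : (E t).toAffine.Nonsingular 0 0 := by
  rw [← WeierstrassCurve.Affine.equation_iff_nonsingular_of_Δ_ne_zero (Δ_ne_zero t),
    WeierstrassCurve.Affine.equation_iff]
  simp

/-- The rational `2`-torsion point `T₁ = (0,0)`. -/
def T₁ (t : ℕ) : (E t).toAffine.Point := WeierstrassCurve.Affine.Point.some 0 0 (nonsingular_zero t)

theorem T₁_add_T₁ (t : ℕ) : T₁ t + T₁ t = 0 := by
  unfold T₁
  apply WeierstrassCurve.Affine.Point.add_self_of_Y_eq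
  simp [WeierstrassCurve.Affine.negY]

/-- Every point of `E_t(ℚ)` killed by `2` is `O` or `(0,0)`: a `2`-torsion point `(x, y)` has `x` a root
of `4x³ + b₂x² + 2b₄x + b₆ = 4x((x+t)²+1)`, so `x = 0`, and `2y + a₁x + a₃ = 0` gives `y = 0`. -/
theorem eq_zero_or_eq_T₁_of_add_self {t : ℕ} {P : (E t).toAffine.Point} (hP : P + P = 0) :
    P = 0 ∨ P = T₁ t := by
  rcases P with _ | ⟨x, y, h⟩
  · exact Or.inl rfl
  · right
    obtain ⟨hy, hroot⟩ := (E t).isRoot_twoTorsionPolynomial_of_add_self_eq_zero hP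
    have hx : x = 0 := by
      simp only [WeierstrassCurve.twoTorsionPolynomial, Cubic.toPoly, Polynomial.IsRoot.def,
        Polynomial.eval_add, Polynomial.eval_mul, Polynomial.eval_C, Polynomial.eval_pow,
        Polynomial.eval_X, WeierstrassCurve.b₂, WeierstrassCurve.b₄, WeierstrassCurve.b₆] at hroot
      have h4 : 4 * x * ((x + t) ^ 2 + 1) = 0 := by linear_combination hroot
      have hpos : (x + t) ^ 2 + 1 ≠ 0 := by positivity
      simpa [hpos] using h4
    subst hx
    have hy0 : y = 0 := by
      simp only [WeierstrassCurve.Affine.negY] at hy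
      linarith
    subst hy0
    rfl

/-- `#E_t(ℚ)[2] = 2`. -/
theorem natCard_twoTorsion (t : ℕ) :
    Nat.card (AddSubgroup.torsionBy (E t).toAffine.Point (2 : ℤ)) = 2 := by
  rw [Nat.card_eq_two_iff]
  have hmem : ∀ P : (E t).toAffine.Point,
      P ∈ AddSubgroup.torsionBy (E t).toAffine.Point (2 : ℤ) ↔ P + P = 0 := by
    intro P
    rw [AddSubgroup.torsionBy, Submodule.mem_toAddSubgroup, Submodule.mem_torsionBy_iff, two_zsmul]
  refine ⟨⟨0, (hmem 0).mpr (by simp)⟩, ⟨T₁ t, (hmem _).mpr (T₁_add_T₁ t)⟩, ?_, ?_⟩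
  · intro h
    have h' := congrArg Subtype.val h
    exact (WeierstrassCurve.Affine.Point.some_ne_zero (nonsingular_zero t)) h'.symm
  · ext P
    simp only [Set.mem_insert_iff, Set.mem_singleton_iff, Set.mem_univ, iff_true]
    rcases eq_zero_or_eq_T₁_of_add_self ((hmem P.1).mp P.2) with h | h
    · exact Or.inl (Subtype.ext h)
    · exact Or.inr (Subtype.ext h)

/-! ## The reduction (sorry-free) -/

/-- Bookkeeping: from `#Sel₂ = 2^s`, Cassels–Tate and `#E_t(ℚ)[2] = 2`, `s = 1 + corank + 2m`. -/
theorem selmerRank_eq (hCT : WeierstrassCurve.exists_casselsTate_pairing (K := ℚ)) (t s : ℕ)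
    (hs : Nat.card ((E t).selmerGroup 2) = 2 ^ s) :
    ∃ m : ℕ, s = 1 + (E t).selmerCorank 2 + 2 * m := by
  have ht : Nat.card (AddSubgroup.torsionBy (E t).toAffine.Point ((2 : ℕ) : ℤ)) = 2 ^ 1 := by
    rw [pow_one]
    exact natCard_twoTorsion t
  exact exists_selmerRank_eq_add hCT (E t) 2 s 1 hs ht

end PointLemmas

/-- **The decomposition, closed form (no sorry).** The five stub statements imply the crux, stated here
with the crux unfolded (only `PencilSelmerDictionary_of` concludes the route decl by name). `h₀` (the
three-Lagrangian parity lemma) and `h₁` (the toric local image) are consumed by `h₃` (relative parity),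
`h₂` (2-adic image constancy mod 8) supplies its equal-image hypotheses at `(t, t % 8 + 8)`, and `h₄`
(Cassels–Tate) converts Selmer 2-ranks into coranks. -/
theorem of_parts
    (h₀ : ∀ (V : Type) [AddCommGroup V] [Module (ZMod 2) V] [Module.Finite (ZMod 2) V]
        (Q : QuadraticForm (ZMod 2) V),
        (∀ x : V, (∀ y : V, QuadraticMap.polar Q x y = 0) → x = 0) →
        ∀ X Y Z : Submodule (ZMod 2) V,
          (∀ x ∈ X, Q x = 0) → (∀ y ∈ Y, Q y = 0) → (∀ z ∈ Z, Q z = 0) →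
          2 * Module.finrank (ZMod 2) X = Module.finrank (ZMod 2) V →
          2 * Module.finrank (ZMod 2) Y = Module.finrank (ZMod 2) V →
          2 * Module.finrank (ZMod 2) Z = Module.finrank (ZMod 2) V →
          Even (Module.finrank (ZMod 2) ↥(X ⊓ Y) + Module.finrank (ZMod 2) ↥(Y ⊓ Z) +
            Module.finrank (ZMod 2) ↥(Z ⊓ X) + Module.finrank (ZMod 2) X))
    (h₁ : ∀ t : ℕ, 1 ≤ t → ∀ (p : ℕ) [Fact p.Prime], p ≠ 2 → ∀ i : ℚ_[p], i ^ 2 = -1 →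
        ‖(t : ℚ_[p]) + i‖ < 1 →
        ∀ x y : ℚ_[p], y ^ 2 = x ^ 3 + 2 * (t : ℚ_[p]) * x ^ 2 + ((t : ℚ_[p]) ^ 2 + 1) * x →
          x ≠ -(t : ℚ_[p]) + i → IsSquare (x - (-(t : ℚ_[p]) + i)))
    (h₂ : ∀ t t' : ℕ, 1 ≤ t → 1 ≤ t' → t ≡ t' [MOD 8] →
        ∀ x y : ℚ_[2], y ^ 2 = x ^ 3 + 2 * (t : ℚ_[2]) * x ^ 2 + ((t : ℚ_[2]) ^ 2 + 1) * x →
          (∃ c d : ℚ_[2], c ^ 2 - d ^ 2 = x + t ∧ 2 * c * d = -1) ∨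
          ∃ x' y' : ℚ_[2], y' ^ 2 = x' ^ 3 + 2 * (t' : ℚ_[2]) * x' ^ 2 + ((t' : ℚ_[2]) ^ 2 + 1) * x' ∧
            ∃ c d : ℚ_[2], c ^ 2 - d ^ 2 = (x + t) * (x' + t') - 1 ∧
              2 * c * d = -((x + t) + (x' + t')))
    (h₃ : (∀ (V : Type) [AddCommGroup V] [Module (ZMod 2) V] [Module.Finite (ZMod 2) V]
         (Q : QuadraticForm (ZMod 2) V),
         (∀ x : V, (∀ y : V, QuadraticMap.polar Q x y = 0) → x = 0) →
         ∀ X Y Z : Submodule (ZMod 2) V,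
           (∀ x ∈ X, Q x = 0) → (∀ y ∈ Y, Q y = 0) → (∀ z ∈ Z, Q z = 0) →
           2 * Module.finrank (ZMod 2) X = Module.finrank (ZMod 2) V →
           2 * Module.finrank (ZMod 2) Y = Module.finrank (ZMod 2) V →
           2 * Module.finrank (ZMod 2) Z = Module.finrank (ZMod 2) V →
           Even (Module.finrank (ZMod 2) ↥(X ⊓ Y) + Module.finrank (ZMod 2) ↥(Y ⊓ Z) +
             Module.finrank (ZMod 2) ↥(Z ⊓ X) + Module.finrank (ZMod 2) X)) →
      (∀ t : ℕ, 1 ≤ t → ∀ (p : ℕ) [Fact p.Prime], p ≠ 2 → ∀ i : ℚ_[p], i ^ 2 = -1 →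
         ‖(t : ℚ_[p]) + i‖ < 1 →
         ∀ x y : ℚ_[p], y ^ 2 = x ^ 3 + 2 * (t : ℚ_[p]) * x ^ 2 + ((t : ℚ_[p]) ^ 2 + 1) * x →
           x ≠ -(t : ℚ_[p]) + i → IsSquare (x - (-(t : ℚ_[p]) + i))) →
      ∀ t t' : ℕ, 1 ≤ t → 1 ≤ t' →
        (∀ x y : ℚ_[2], y ^ 2 = x ^ 3 + 2 * (t : ℚ_[2]) * x ^ 2 + ((t : ℚ_[2]) ^ 2 + 1) * x →
          (∃ c d : ℚ_[2], c ^ 2 - d ^ 2 = x + t ∧ 2 * c * d = -1) ∨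
          ∃ x' y' : ℚ_[2], y' ^ 2 = x' ^ 3 + 2 * (t' : ℚ_[2]) * x' ^ 2 + ((t' : ℚ_[2]) ^ 2 + 1) * x' ∧
            ∃ c d : ℚ_[2], c ^ 2 - d ^ 2 = (x + t) * (x' + t') - 1 ∧
              2 * c * d = -((x + t) + (x' + t'))) →
        (∀ x' y' : ℚ_[2], y' ^ 2 = x' ^ 3 + 2 * (t' : ℚ_[2]) * x' ^ 2 + ((t' : ℚ_[2]) ^ 2 + 1) * x' →
          (∃ c d : ℚ_[2], c ^ 2 - d ^ 2 = x' + t' ∧ 2 * c * d = -1) ∨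
          ∃ x y : ℚ_[2], y ^ 2 = x ^ 3 + 2 * (t : ℚ_[2]) * x ^ 2 + ((t : ℚ_[2]) ^ 2 + 1) * x ∧
            ∃ c d : ℚ_[2], c ^ 2 - d ^ 2 = (x' + t') * (x + t) - 1 ∧
              2 * c * d = -((x' + t') + (x + t))) →
        ∀ s s' : ℕ,
          Nat.card ((⟨0, 2 * (t : ℚ), 0, (t : ℚ) ^ 2 + 1, 0⟩ : WeierstrassCurve ℚ).selmerGroup 2) = 2 ^ s →
          Nat.card ((⟨0, 2 * (t' : ℚ), 0, (t' : ℚ) ^ 2 + 1, 0⟩ : WeierstrassCurve ℚ).selmerGroup 2) = 2 ^ s' →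
          Even (s + s' +
            (((t ^ 2 + 1).primeFactors.filter (fun p : ℕ => p ≠ 2)) \
              ((t' ^ 2 + 1).primeFactors.filter (fun p : ℕ => p ≠ 2))).card +
            (((t' ^ 2 + 1).primeFactors.filter (fun p : ℕ => p ≠ 2)) \
              ((t ^ 2 + 1).primeFactors.filter (fun p : ℕ => p ≠ 2))).card))
    (h₄ : WeierstrassCurve.exists_casselsTate_pairing (K := ℚ)) :
    ∃ M : ℕ, ∃ w : ℕ → ℤ, (∀ t : ℕ, w (t + 2 ^ M) = w t) ∧ ∀ t : ℕ, 1 ≤ t →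
      (-1 : ℤ) ^ (WeierstrassCurve.selmerCorank
        (⟨0, 2 * (t : ℚ), 0, (t : ℚ) ^ 2 + 1, 0⟩ : WeierstrassCurve ℚ) 2) =
      -(w t * (-1 : ℤ) ^ (((t ^ 2 + 1).primeFactors.filter (fun p : ℕ => p ≠ 2)).card)) := by
  have hM := h₂
  -- `M = 3`; the base point of the class of `t`: `r t = t mod 8 + 8 ≥ 1`, `r t ≡ t (mod 8)`
  let r : ℕ → ℕ := fun t => t % 8 + 8
  have hr1 : ∀ t, 1 ≤ r t := fun t => le_add_left (by norm_num)
  have hrmod : ∀ t, r t ≡ t [MOD 8] := fun t => by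
    show (t % 8 + 8) % 8 = t % 8
    rw [Nat.add_mod_right, Nat.mod_mod]
  have hrper : ∀ t, r (t + 2 ^ 3) = r t := fun t => by
    show (t + 2 ^ 3) % 8 + 8 = t % 8 + 8
    rw [show (2 : ℕ) ^ 3 = 8 from rfl, Nat.add_mod_right]
  -- σ(t) = (−1)^{corank + ω}; w(t) := −σ(r t)
  refine ⟨3, fun t => -((-1 : ℤ) ^ ((E (r t)).selmerCorank 2 + ω (r t))), fun t => by
    simp only [hrper], ?_⟩
  intro t ht
  -- Selmer 2-ranks of the two fibres `t` and `r t`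
  obtain ⟨s, hs⟩ := exists_natCard_selmerGroup_eq_pow (E t) 2
  obtain ⟨s', hs'⟩ := exists_natCard_selmerGroup_eq_pow (E (r t)) 2
  -- relative parity (stub 4 fed with stubs 1, 2, 3)
  have hsub := hM t (r t) ht (hr1 t) ((hrmod t).symm)
  have hsub' := hM (r t) t (hr1 t) ht (hrmod t)
  have hpar : Even (s + s' + (oddPF t \ oddPF (r t)).card + (oddPF (r t) \ oddPF t).card) :=
    h₃ h₀ h₁ t (r t) ht (hr1 t) hsub hsub' s s' hs hs'
  -- Cassels–Tate bookkeeping on both fibres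
  obtain ⟨m, hm⟩ := selmerRank_eq h₄ t s hs
  obtain ⟨m', hm'⟩ := selmerRank_eq h₄ (r t) s' hs'
  -- parity arithmetic: `#(A ∖ B) + #(B ∖ A) ≡ #A + #B (mod 2)`
  obtain ⟨k, hk⟩ := hpar
  have hA := Finset.card_sdiff_add_card_inter (oddPF t) (oddPF (r t))
  have hB := Finset.card_sdiff_add_card_inter (oddPF (r t)) (oddPF t)
  rw [Finset.inter_comm] at hB
  have key : ((E t).selmerCorank 2) % 2 = ((E (r t)).selmerCorank 2 + ω (r t) + ω t) % 2 := by
    simp only [ω] at *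
    omega
  show (-1 : ℤ) ^ ((E t).selmerCorank 2) = -(-((-1 : ℤ) ^ ((E (r t)).selmerCorank 2 + ω (r t))) *
    (-1 : ℤ) ^ (ω t))
  rw [neg_mul, neg_neg, ← pow_add, neg_one_pow_eq_pow_mod_two, key, ← neg_one_pow_eq_pow_mod_two]

/-- **Skeleton theorem**: the crux BY NAME from the five registered stubs. -/
theorem PencilSelmerDictionary_of :
    Summit.Parity.BatemanHorn.Theses.IsogenyRedei.PencilSelmerDictionary :=
  of_parts stub_threeLagrangianParity stub_toricKummerImage stub_twoAdicKummerImage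
    stub_relativeParity stub_casselsTatePairing

end Summit.Parity.BatemanHorn.Cruxes.PencilSelmerDictionary.IsotrivialTwoTorsionRelativeParity
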